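import Summits.Ventures.PercRepro.OrbitK

/-!
# PercRepro — the generic credit identity `Σ_{x=1}^{p−q−1} C(p, x) / C(x+q, q) = Φ(p, q)` (p2, gen 5)

In mine-2's per-flat bookkeeping for C-025 (`MINE2-RLS.md` §18.1) a rank-`q` flat met GENERICALLY by `p` outside points
receives, from the sets `S = T ∪ X` (`T` a rank-`q` bottom set of the flat, `X` a set of `x` outside points,
`1 ≤ x ≤ p − q − 1`), the credit `C(p, x) / C(x + q, q)` at each size `x` — and the total is exactly `Φ(p, q)`:
`credit(p, p, q) = Σ_x C(p, x) / C(x+q, q) = Φ(p, q)` (mine-2 checked `q = 3`, `p = 5, 6, 7` numerically).  This is the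
base case of every per-flat certificate (the generic flat is tight), and at `q = 2` it is the binomial layer behind
Theorem N's `(N1)`.  The identity is the product formula `C(p, x) · C(p+q, q) = C(p+q, x+q) · C(x+q, q)`
(`Nat.choose_mul`) plus the reindexing `u = x + q` of the sum defining `phiK`.

* `choose_mul_choose_eq`: `C(p, x) · C(p+q, q) = C(p+q, x+q) · C(x+q, q)`;
* `phiK_eq_sum_credit`: `Φ(p, q) = Σ_{x ∈ Icc 1 (p−q−1)} C(p, x) / C(x+q, q)` for `q + 1 ≤ p`;
* the values `Φ(6, 3) = 3`, `Φ(6, 4) = 6/5`, `Φ(7, 3) = 28/5`, `Φ(7, 4) = 14/5` of the open core (`(5, 3)`: `phiK_five_three = 5/4` in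
  `RankLevelSetO.lean`).
-/

namespace PercRepro

open Finset

/-- `C(p, x) · C(p+q, q) = C(p+q, x+q) · C(x+q, q)` (the three-factor rearrangement `Nat.choose_mul`). -/
theorem choose_mul_choose_eq (p q x : ℕ) :
    Nat.choose p x * Nat.choose (p + q) q = Nat.choose (p + q) (x + q) * Nat.choose (x + q) q := by
  have h := Nat.choose_mul (n := p + q) (k := x + q) (s := q) (by omega)
  rw [Nat.add_sub_cancel, Nat.add_sub_cancel] at h
  rw [mul_comm]
  exact h.symm

/-- The image of `Icc 1 (p − q − 1)` under `x ↦ x + q` is `Ioo q p` (for `q + 1 ≤ p`). -/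
theorem Ioo_eq_map (p q : ℕ) (hpq : q + 1 ≤ p) :
    Finset.Ioo q p = (Finset.Icc 1 (p - q - 1)).map (addRightEmbedding q) := by
  ext u
  simp only [Finset.mem_Ioo, Finset.mem_map, Finset.mem_Icc, addRightEmbedding_apply]
  constructor
  · rintro ⟨h1, h2⟩
    exact ⟨u - q, ⟨by omega, by omega⟩, by omega⟩
  · rintro ⟨x, ⟨h1, h2⟩, rfl⟩
    omega

/-- **The generic credit identity**: `Φ(p, q) = Σ_{x=1}^{p−q−1} C(p, x) / C(x+q, q)`. -/
theorem phiK_eq_sum_credit (p q : ℕ) (hpq : q + 1 ≤ p) :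
    phiK p q = ∑ x ∈ Finset.Icc 1 (p - q - 1), (Nat.choose p x : ℚ) / (Nat.choose (x + q) q : ℚ) := by
  unfold phiK
  rw [Ioo_eq_map p q hpq, Finset.sum_map, Finset.sum_div]
  apply Finset.sum_congr rfl
  intro x hx
  simp only [addRightEmbedding_apply]
  have hq : (Nat.choose (x + q) q : ℚ) ≠ 0 := by
    exact_mod_cast (Nat.choose_pos (by omega : q ≤ x + q)).ne'
  have hp : (Nat.choose (p + q) p : ℚ) ≠ 0 := by
    exact_mod_cast (Nat.choose_pos (by omega : p ≤ p + q)).ne'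
  rw [div_eq_div_iff hp hq]
  have h := choose_mul_choose_eq p q x
  rw [← Nat.choose_symm_add] at h
  exact_mod_cast h.symm

/-- `Φ(6, 3) = 3`. -/
theorem phiK_six_three : phiK 6 3 = 3 := by
  unfold phiK
  rw [show Finset.Ioo 3 6 = {4, 5} from by decide, Finset.sum_pair (by decide),
    show Nat.choose 9 4 = 126 by decide, show Nat.choose 9 5 = 126 by decide, show Nat.choose 9 6 = 84 by decide]
  norm_num

/-- `Φ(6, 4) = 6/5`. -/
theorem phiK_six_four : phiK 6 4 = 6 / 5 := by
  unfold phiK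
  rw [show Finset.Ioo 4 6 = {5} from by decide, Finset.sum_singleton,
    show Nat.choose 10 5 = 252 by decide, show Nat.choose 10 6 = 210 by decide]
  norm_num

/-- `Φ(7, 3) = 28/5`. -/
theorem phiK_seven_three : phiK 7 3 = 28 / 5 := by
  unfold phiK
  rw [show Finset.Ioo 3 7 = {4, 5, 6} from by decide, Finset.sum_insert (by decide), Finset.sum_pair (by decide),
    show Nat.choose 10 4 = 210 by decide, show Nat.choose 10 5 = 252 by decide, show Nat.choose 10 6 = 210 by decide,
    show Nat.choose 10 7 = 120 by decide]
  norm_num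

/-- `Φ(7, 4) = 14/5`. -/
theorem phiK_seven_four : phiK 7 4 = 14 / 5 := by
  unfold phiK
  rw [show Finset.Ioo 4 7 = {5, 6} from by decide, Finset.sum_pair (by decide),
    show Nat.choose 11 5 = 462 by decide, show Nat.choose 11 6 = 462 by decide, show Nat.choose 11 7 = 330 by decide]
  norm_num

end PercRepro
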